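import Mathlib
import HarnessLib
import Summits.HubbardSuperconductivity.HubbardSuperconductivity.Theorems.KLProgrammeMatsubaraLadderBubbleTransfer

/-!
# Route `KLProgramme` — ENGINE (stmt-HubbardSuperconductivity-20437 `KLRegimeEngineV17F2`), row (c) binder #8 (`hexLadMV` ★ v19), E1-LEDGER line #8 LANE item
# «(F2)¹ one loop, FORWARD branch», part 2: THE LADDER LAW — the transfer perturbation of the bubble above scale `Λ_{n'}` summed over slice pairs
# (cell gate-hubbard-kl, seat hubbard-kl-k3c2-p2 g33, technique «thermal-bar induction n ≤ nScales β + 1 with EngineBoundsAtV4S sums»)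

Continues `…MatsubaraLadderBubbleTransfer` (pair lemmas same/up/down, support gap, ladder arithmetic).  Here, for standard slice families
`f_m, f'_m` (sup `M_f, M_f'`, `L_f'(m) ≤ ℓ'/Λ_m²`, supports `(Λ_m/2)² < s < (4Λ_m)²`), insertion `‖W‖ ≤ B_W` on `|e| < 4Λ₀`, shift `|δ| ≤ δ_max`:
* `kllb_pair_eq_zero_of_far` — for `|q₀| + δ_max ≤ Λ_m/4` the pair `(m, m')` perturbation is `0` unless `|m − m'| ≤ 1`;
* `kllb_row_sum_le` — one row: `Σ_{m' ≤ n'} ‖pair (m, m')‖ ≤ (1024/π)·M_f·(1584ℓ' + 6354M_f')·B_W·(|q₀| + δ_max)/Λ_m`;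
* **`kllb_ladder_bubble_shift_norm_le`** — for `n' ≤ n_β + 1`, `|q₀| + δ_max ≤ Λ_{n'}/4`:
  `Σ_{m ≤ n'} Σ_{m' ≤ n'} ‖β⁻¹Σ_i ∫ W·Φ_m·(Ψ_{m'}(ω_i+q₀, e+δ(e)) − Ψ_{m'}(ω_i,e)) de‖ ≤ (4/3)·(1024/π)·M_f·(1584ℓ' + 6354M_f')·B_W·(|q₀| + δ_max)/Λ_{n'}`,
  i.e. the bubble above scale `Λ_{n'}` is transfer-Lipschitz with constant `∝ 1/Λ_{n'}` — the `N0/Λ_{n'}` forward-branch law of (F2)¹ in the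
  lineage's radial Matsubara model, every `M`, every `β ≥ klBetaMin`;
* `kllb_ladder_bubble_lipschitz` — the same as `‖B(q₀, δ) − B(0, 0)‖ ≤ …` for the double-sum bubble `B` itself (continuous `W`, `δ`: every pair
  integrand is continuous with compact support, so the difference of the bubbles IS the sum of the pair perturbations).
Pure analysis over landed lemmas; no definitions; nothing about the model, (c), K3 or superconductivity is asserted.
References: E1-LEDGER-AT-KILL rev 14 §17 (F2); Salmhofer, *Renormalization* (1999) Prop. 4.13 (4.225); BGM 2006 §2.5.
-/

noncomputable section

namespace Summit.HubbardSuperconductivity.HubbardSuperconductivity.Theorems.KLRegimeSplit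

set_option linter.dupNamespace false -- summit = problem name (single-conjunct summit), D-0017

open Real Finset MeasureTheory Complex Literature.MathematicalPhysics.QuantumLattice Literature.Probability.LatticeModels
open Summit.HubbardSuperconductivity.HubbardSuperconductivity.Theorems.KLProgrammeLegKernels

section LadderLaw

variable {f f' : ℕ → ℝ → ℂ} {Mf Mf' ℓ' : ℝ} {Lf' : ℕ → ℝ} {W : ℝ → ℂ} {δ : ℝ → ℝ} {BW δmax : ℝ}

/-- **Non-adjacent pairs vanish.**  For slice families with the standard supports (`f_m = 0` for `s ≤ (Λ_m/2)²` and for `s ≥ (4Λ_m)²`, same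
for `f'`) and a transfer with `|q₀| + δ_max ≤ Λ_m/4`, the pair bubble perturbation of `(m, m')` is ZERO whenever `m + 2 ≤ m'` or `m' + 2 ≤ m`. -/
theorem kllb_pair_eq_zero_of_far
    (hin : ∀ m s, s ≤ (klScale klE0 m / 2) ^ 2 → f m s = 0) (hout : ∀ m s, (4 * klScale klE0 m) ^ 2 ≤ s → f m s = 0)
    (hin' : ∀ m s, s ≤ (klScale klE0 m / 2) ^ 2 → f' m s = 0) (hout' : ∀ m s, (4 * klScale klE0 m) ^ 2 ≤ s → f' m s = 0)
    (hδ : ∀ e, |δ e| ≤ δmax) {q₀ : ℝ} {m m' : ℕ} (hD : |q₀| + δmax ≤ klScale klE0 m / 4) (hfar : m + 2 ≤ m' ∨ m' + 2 ≤ m)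
    (β : ℝ) (M : ℕ) :
    β⁻¹ • ∑ i : MatsubaraIdx M, ∫ e,
        W e * (f m (matsubaraFreq β M i ^ 2 + e ^ 2) / (((matsubaraFreq β M i ^ 2 + e ^ 2 : ℝ)) : ℂ) * (I * (matsubaraFreq β M i) + e)) *
          (f' m' ((matsubaraFreq β M i + q₀) ^ 2 + (e + δ e) ^ 2) / ((((matsubaraFreq β M i + q₀) ^ 2 + (e + δ e) ^ 2 : ℝ)) : ℂ) *
              (I * ((matsubaraFreq β M i + q₀ : ℝ) : ℂ) + ((e + δ e : ℝ) : ℂ)) -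
            f' m' (matsubaraFreq β M i ^ 2 + e ^ 2) / (((matsubaraFreq β M i ^ 2 + e ^ 2 : ℝ)) : ℂ) * (I * (matsubaraFreq β M i) + e)) = 0 := by
  have hΛm := klth_klScale_pos m
  have hzero : ∀ (k₀ e : ℝ),
      W e * (f m (k₀ ^ 2 + e ^ 2) / (((k₀ ^ 2 + e ^ 2 : ℝ)) : ℂ) * (I * k₀ + e)) *
        (f' m' ((k₀ + q₀) ^ 2 + (e + δ e) ^ 2) / ((((k₀ + q₀) ^ 2 + (e + δ e) ^ 2 : ℝ)) : ℂ) *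
            (I * ((k₀ + q₀ : ℝ) : ℂ) + ((e + δ e : ℝ) : ℂ)) -
          f' m' (k₀ ^ 2 + e ^ 2) / (((k₀ ^ 2 + e ^ 2 : ℝ)) : ℂ) * (I * k₀ + e)) = 0 := by
    intro k₀ e
    have hδe : |q₀| + |δ e| ≤ klScale klE0 m / 4 := by linarith [hδ e]
    rcases hfar with h | h
    · -- second line far inside: `4Λ_{m'} ≤ Λ_m/4`
      have hle : klScale klE0 m' ≤ klScale klE0 m / 16 := by
        rw [← kllb_klScale_succ_succ]; exact klld_klScale_anti h
      refine kllb_pair_integrand_eq_zero_of_inner (R₁ := klScale klE0 m / 2) (R₂ := 4 * klScale klE0 m') (hin m) (hout' m')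
        (by linarith [klth_klScale_pos m']) ?_ (W e)
      linarith
    · -- second line far outside: `Λ_{m'}/2 ≥ 8Λ_m`
      have hle : klScale klE0 m ≤ klScale klE0 m' / 16 := by
        rw [← kllb_klScale_succ_succ]; exact klld_klScale_anti h
      refine kllb_pair_integrand_eq_zero_of_outer (R₁ := 4 * klScale klE0 m) (R₂ := klScale klE0 m' / 2) (hout m) (by positivity)
        (hin' m') ?_ (W e)
      linarith
  simp only [hzero, integral_zero, sum_const_zero, smul_zero]

/-- **One row of the ladder.**  Standard slice families (`‖f_m‖ ≤ M_f`, supports `(Λ_m/2)² < s < (4Λ_m)²`; `‖f'_m‖ ≤ M_f'`, `L_f'(m)`-Lipschitz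
with `L_f'(m) ≤ ℓ'/Λ_m²`, same supports), `‖W‖ ≤ B_W` on `|e| < 4Λ₀`, `|δ| ≤ δ_max`, `|q₀| + δ_max ≤ Λ_m/4`, `m ≤ n' ≤ n_β + 1`.  Then the row sum
over the second line's slice `m' ≤ n'` of the pair perturbations is at most `(1024/π)·M_f·(1584ℓ' + 6354M_f')·B_W·(|q₀| + δ_max)/Λ_m`
(same slice `48/193` + one finer `768/3088` + one coarser `768/3073`; all other pairs vanish, `kllb_pair_eq_zero_of_far`). -/
theorem kllb_row_sum_le (hbd : ∀ m s, ‖f m s‖ ≤ Mf)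
    (hin : ∀ m s, s ≤ (klScale klE0 m / 2) ^ 2 → f m s = 0) (hout : ∀ m s, (4 * klScale klE0 m) ^ 2 ≤ s → f m s = 0)
    (hlip' : ∀ m s s', ‖f' m s - f' m s'‖ ≤ Lf' m * |s - s'|) (hbd' : ∀ m s, ‖f' m s‖ ≤ Mf') (hLf' : ∀ m, Lf' m ≤ ℓ' / klScale klE0 m ^ 2)
    (hin' : ∀ m s, s ≤ (klScale klE0 m / 2) ^ 2 → f' m s = 0) (hout' : ∀ m s, (4 * klScale klE0 m) ^ 2 ≤ s → f' m s = 0)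
    (hBW : 0 ≤ BW) (hWbd : ∀ e, |e| < 4 * klScale klE0 0 → ‖W e‖ ≤ BW) (hδ0 : 0 ≤ δmax) (hδ : ∀ e, |δ e| ≤ δmax)
    {q₀ : ℝ} {β : ℝ} (hβ : klBetaMin ≤ β) {n' : ℕ} (hn' : n' ≤ nScales β + 1) (M : ℕ) {m : ℕ} (hm : m ≤ n')
    (hD : |q₀| + δmax ≤ klScale klE0 m / 4) :
    ∑ m' ∈ range (n' + 1), ‖β⁻¹ • ∑ i : MatsubaraIdx M, ∫ e,
        W e * (f m (matsubaraFreq β M i ^ 2 + e ^ 2) / (((matsubaraFreq β M i ^ 2 + e ^ 2 : ℝ)) : ℂ) * (I * (matsubaraFreq β M i) + e)) *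
          (f' m' ((matsubaraFreq β M i + q₀) ^ 2 + (e + δ e) ^ 2) / ((((matsubaraFreq β M i + q₀) ^ 2 + (e + δ e) ^ 2 : ℝ)) : ℂ) *
              (I * ((matsubaraFreq β M i + q₀ : ℝ) : ℂ) + ((e + δ e : ℝ) : ℂ)) -
            f' m' (matsubaraFreq β M i ^ 2 + e ^ 2) / (((matsubaraFreq β M i ^ 2 + e ^ 2 : ℝ)) : ℂ) * (I * (matsubaraFreq β M i) + e))‖ ≤
      1024 / Real.pi * Mf * (1584 * ℓ' + 6354 * Mf') * BW * (|q₀| + δmax) / klScale klE0 m := by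
  have hΛm := klth_klScale_pos m
  have hMf : 0 ≤ Mf := (norm_nonneg _).trans (hbd 0 0)
  have hMf' : 0 ≤ Mf' := (norm_nonneg _).trans (hbd' 0 0)
  have hℓ' : 0 ≤ ℓ' := by
    have hL0 : 0 ≤ Lf' 0 := by
      have := hlip' 0 0 1; have h0 : (0:ℝ) ≤ ‖f' 0 0 - f' 0 1‖ := norm_nonneg _; norm_num at this; linarith
    have : 0 ≤ ℓ' / klScale klE0 0 ^ 2 := hL0.trans (hLf' 0)
    rwa [le_div_iff₀ (by positivity [klth_klScale_pos 0]), zero_mul] at this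
  have hD0 : 0 ≤ |q₀| + δmax := by positivity
  -- `W` is bounded on every slice box
  have hWm : ∀ k, ∀ e, |e| < 4 * klScale klE0 k → ‖W e‖ ≤ BW := fun k e he =>
    hWbd e (he.trans_le (by linarith [klld_klScale_anti (Nat.zero_le k)]))
  -- the three constants
  set D : ℝ := |q₀| + δmax with hDdef
  set Cs : ℝ := 1024 / Real.pi * Mf * (48 * ℓ' + 193 * Mf') * BW * D / klScale klE0 m with hCs
  set Cu : ℝ := 1024 / Real.pi * Mf * (768 * ℓ' + 3088 * Mf') * BW * D / klScale klE0 m with hCu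
  set Cd : ℝ := 1024 / Real.pi * Mf * (768 * ℓ' + 3073 * Mf') * BW * D / klScale klE0 m with hCd
  have hCs0 : 0 ≤ Cs := by positivity
  have hCu0 : 0 ≤ Cu := by positivity
  have hCd0 : 0 ≤ Cd := by positivity
  -- name the summand
  set g : ℕ → ℝ := fun m' => ‖β⁻¹ • ∑ i : MatsubaraIdx M, ∫ e,
        W e * (f m (matsubaraFreq β M i ^ 2 + e ^ 2) / (((matsubaraFreq β M i ^ 2 + e ^ 2 : ℝ)) : ℂ) * (I * (matsubaraFreq β M i) + e)) *
          (f' m' ((matsubaraFreq β M i + q₀) ^ 2 + (e + δ e) ^ 2) / ((((matsubaraFreq β M i + q₀) ^ 2 + (e + δ e) ^ 2 : ℝ)) : ℂ) *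
              (I * ((matsubaraFreq β M i + q₀ : ℝ) : ℂ) + ((e + δ e : ℝ) : ℂ)) -
            f' m' (matsubaraFreq β M i ^ 2 + e ^ 2) / (((matsubaraFreq β M i ^ 2 + e ^ 2 : ℝ)) : ℂ) * (I * (matsubaraFreq β M i) + e))‖
    with hg
  have hmn : m ≤ nScales β + 1 := hm.trans hn'
  -- the three non-zero entries
  have hsame : g m ≤ Cs :=
    klsp_slice_bubble_shift_norm_le (hbd m) (hin m) (hout m) (hlip' m) (hbd' m) (hLf' m) (hin' m) (hout' m) hBW (hWm m) hδ0 hδ q₀ hβ hmn M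
  have hup : g (m + 1) ≤ Cu :=
    klsp_slice_bubble_shift_norm_le_up (hbd m) (hin m) (hout m) (hlip' (m + 1)) (hbd' (m + 1)) (hLf' (m + 1)) (hin' (m + 1)) (hout' (m + 1))
      hBW (hWm m) hδ0 hδ q₀ hβ hmn M
  have hdown : ∀ k, m = k + 1 → g k ≤ Cd := by
    rintro k rfl
    exact klsp_slice_bubble_shift_norm_le_down (hbd (k + 1)) (hin (k + 1)) (hout (k + 1)) (hlip' k) (hbd' k) (hLf' k) (hin' k) (hout' k)
      hBW (hWm (k + 1)) hδ0 hδ q₀ hβ hmn M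
  have hfar : ∀ m', (m + 2 ≤ m' ∨ m' + 2 ≤ m) → g m' = 0 := fun m' h => by
    simp only [hg, kllb_pair_eq_zero_of_far hin hout hin' hout' hδ hD h β M, norm_zero]
  -- pointwise comparison with three indicator terms
  have hpt : ∀ m' ∈ range (n' + 1), g m' ≤
      (if m' = m then Cs else 0) + (if m' = m + 1 then Cu else 0) + (if m' + 1 = m then Cd else 0) := by
    intro m' _
    by_cases h1 : m' = m
    · subst h1; simp only [if_true]
      have : ¬ (m' + 1 = m') := by omega
      simp only [show ¬ (m' = m' + 1) by omega, this, if_false, add_zero]; exact hsame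
    by_cases h2 : m' = m + 1
    · subst h2
      simp only [show ¬ (m + 1 = m) by omega, show ¬ (m + 1 + 1 = m) by omega, if_false, if_true, zero_add, add_zero]; exact hup
    by_cases h3 : m' + 1 = m
    · simp only [h1, h2, h3, if_false, if_true, zero_add]; exact hdown m' h3.symm
    · simp only [h1, h2, h3, if_false, add_zero]
      exact le_of_eq (hfar m' (by omega))
  refine (sum_le_sum hpt).trans ?_
  rw [sum_add_distrib, sum_add_distrib, sum_ite_eq' (range (n' + 1)) m, sum_ite_eq' (range (n' + 1)) (m + 1)]
  have h3 : ∑ m' ∈ range (n' + 1), (if m' + 1 = m then Cd else 0) ≤ Cd := by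
    rcases Nat.eq_zero_or_eq_succ_pred m with h0 | hs
    · rw [sum_eq_zero fun m' _ => by rw [if_neg (by omega)]]; exact hCd0
    · rw [show (fun m' => if m' + 1 = m then Cd else (0:ℝ)) = fun m' => if m' = m - 1 then Cd else 0 from
        funext fun m' => by congr 1; exact propext ⟨fun h => by omega, fun h => by omega⟩, sum_ite_eq']
      split_ifs <;> linarith
  have h1 : (if m ∈ range (n' + 1) then Cs else 0) ≤ Cs := by split_ifs <;> linarith
  have h2 : (if m + 1 ∈ range (n' + 1) then Cu else 0) ≤ Cu := by split_ifs <;> linarith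
  have htot : Cs + Cu + Cd = 1024 / Real.pi * Mf * (1584 * ℓ' + 6354 * Mf') * BW * D / klScale klE0 m := by
    rw [hCs, hCu, hCd]; field_simp; ring
  linarith

/-- **THE LADDER LAW (E1-LEDGER §17 (F2)¹, forward branch).**  Standard slice families `f_m, f'_m` (sup `M_f, M_f'`, second family
`L_f'(m)`-Lipschitz with `L_f'(m) ≤ ℓ'/Λ_m²`, supports `(Λ_m/2)² < s < (4Λ_m)²`), insertion `‖W(e)‖ ≤ B_W` for `|e| < 4Λ₀`, shift `|δ| ≤ δ_max`,
SMALL TRANSFER `|q₀| + δ_max ≤ Λ_{n'}/4`, `n' ≤ n_β + 1`, `β ≥ klBetaMin`, any `M`.  Then the double sum over slice pairs `(m, m')`, `m, m' ≤ n'`, of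
the pair transfer perturbations `‖β⁻¹Σ_i ∫ W·Φ_m·(Ψ_{m'}(ω_i+q₀, e+δ(e)) − Ψ_{m'}(ω_i, e)) de‖` is at most
`(4/3)·(1024/π)·M_f·(1584ℓ' + 6354M_f')·B_W·(|q₀| + δ_max)/Λ_{n'}`: the above-scale bubble `χ^{>Λ_{n'}}` is transfer-Lipschitz with constant
`∝ 1/Λ_{n'}` (rows `kllb_row_sum_le` summed by the (T)-ladder arithmetic `kllb_ladder_sum_le`). -/
theorem kllb_ladder_bubble_shift_norm_le (hbd : ∀ m s, ‖f m s‖ ≤ Mf)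
    (hin : ∀ m s, s ≤ (klScale klE0 m / 2) ^ 2 → f m s = 0) (hout : ∀ m s, (4 * klScale klE0 m) ^ 2 ≤ s → f m s = 0)
    (hlip' : ∀ m s s', ‖f' m s - f' m s'‖ ≤ Lf' m * |s - s'|) (hbd' : ∀ m s, ‖f' m s‖ ≤ Mf') (hLf' : ∀ m, Lf' m ≤ ℓ' / klScale klE0 m ^ 2)
    (hin' : ∀ m s, s ≤ (klScale klE0 m / 2) ^ 2 → f' m s = 0) (hout' : ∀ m s, (4 * klScale klE0 m) ^ 2 ≤ s → f' m s = 0)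
    (hBW : 0 ≤ BW) (hWbd : ∀ e, |e| < 4 * klScale klE0 0 → ‖W e‖ ≤ BW) (hδ0 : 0 ≤ δmax) (hδ : ∀ e, |δ e| ≤ δmax)
    {q₀ : ℝ} {β : ℝ} (hβ : klBetaMin ≤ β) {n' : ℕ} (hn' : n' ≤ nScales β + 1) (M : ℕ)
    (hD : |q₀| + δmax ≤ klScale klE0 n' / 4) :
    ∑ m ∈ range (n' + 1), ∑ m' ∈ range (n' + 1), ‖β⁻¹ • ∑ i : MatsubaraIdx M, ∫ e,
        W e * (f m (matsubaraFreq β M i ^ 2 + e ^ 2) / (((matsubaraFreq β M i ^ 2 + e ^ 2 : ℝ)) : ℂ) * (I * (matsubaraFreq β M i) + e)) *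
          (f' m' ((matsubaraFreq β M i + q₀) ^ 2 + (e + δ e) ^ 2) / ((((matsubaraFreq β M i + q₀) ^ 2 + (e + δ e) ^ 2 : ℝ)) : ℂ) *
              (I * ((matsubaraFreq β M i + q₀ : ℝ) : ℂ) + ((e + δ e : ℝ) : ℂ)) -
            f' m' (matsubaraFreq β M i ^ 2 + e ^ 2) / (((matsubaraFreq β M i ^ 2 + e ^ 2 : ℝ)) : ℂ) * (I * (matsubaraFreq β M i) + e))‖ ≤
      4 / 3 * (1024 / Real.pi * Mf * (1584 * ℓ' + 6354 * Mf') * BW * (|q₀| + δmax)) / klScale klE0 n' := by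
  have hMf : 0 ≤ Mf := (norm_nonneg _).trans (hbd 0 0)
  have hMf' : 0 ≤ Mf' := (norm_nonneg _).trans (hbd' 0 0)
  have hℓ' : 0 ≤ ℓ' := by
    have hL0 : 0 ≤ Lf' 0 := by
      have := hlip' 0 0 1; have h0 : (0:ℝ) ≤ ‖f' 0 0 - f' 0 1‖ := norm_nonneg _; norm_num at this; linarith
    have : 0 ≤ ℓ' / klScale klE0 0 ^ 2 := hL0.trans (hLf' 0)
    rwa [le_div_iff₀ (by positivity [klth_klScale_pos 0]), zero_mul] at this
  refine kllb_ladder_sum_le (by positivity) fun m hm => ?_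
  have hDm : |q₀| + δmax ≤ klScale klE0 m / 4 := hD.trans (by linarith [klld_klScale_anti hm])
  have h := kllb_row_sum_le hbd hin hout hlip' hbd' hLf' hin' hout' hBW hWbd hδ0 hδ hβ hn' M hm hDm
  exact h

end LadderLaw

/-! ## §5 Corollary: the above-scale bubble is transfer-Lipschitz (difference of the bubble AT transfer and at ZERO transfer) -/

section Lipschitz

variable {f f' : ℕ → ℝ → ℂ} {Mf Mf' ℓ' : ℝ} {Lf Lf' : ℕ → ℝ} {W : ℝ → ℂ} {δ : ℝ → ℝ} {BW δmax : ℝ}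

/-- **The above-scale bubble at transfer `(q₀, δ)` minus the same bubble at zero transfer.**  Under the hypotheses of
`kllb_ladder_bubble_shift_norm_le` plus continuity of the insertion `W` and of the shift `δ` and Lipschitz first-family weights (so that every pair
integrand is continuous with compact support, hence integrable, and the difference of the two double sums IS the double sum of the pair
perturbations): `‖B(q₀, δ) − B(0, 0)‖ ≤ (4/3)·(1024/π)·M_f·(1584ℓ' + 6354M_f')·B_W·(|q₀| + δ_max)/Λ_{n'}`, where
`B(q₀, δ) = Σ_{m ≤ n'} Σ_{m' ≤ n'} β⁻¹Σ_i ∫ W(e)·Φ_m(ω_i,e)·Ψ_{m'}(ω_i+q₀, e+δ(e)) de`. -/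
theorem kllb_ladder_bubble_lipschitz (hlip : ∀ m s s', ‖f m s - f m s'‖ ≤ Lf m * |s - s'|) (hbd : ∀ m s, ‖f m s‖ ≤ Mf)
    (hin : ∀ m s, s ≤ (klScale klE0 m / 2) ^ 2 → f m s = 0) (hout : ∀ m s, (4 * klScale klE0 m) ^ 2 ≤ s → f m s = 0)
    (hlip' : ∀ m s s', ‖f' m s - f' m s'‖ ≤ Lf' m * |s - s'|) (hbd' : ∀ m s, ‖f' m s‖ ≤ Mf') (hLf' : ∀ m, Lf' m ≤ ℓ' / klScale klE0 m ^ 2)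
    (hin' : ∀ m s, s ≤ (klScale klE0 m / 2) ^ 2 → f' m s = 0) (hout' : ∀ m s, (4 * klScale klE0 m) ^ 2 ≤ s → f' m s = 0)
    (hW : Continuous W) (hBW : 0 ≤ BW) (hWbd : ∀ e, |e| < 4 * klScale klE0 0 → ‖W e‖ ≤ BW)
    (hδc : Continuous δ) (hδ0 : 0 ≤ δmax) (hδ : ∀ e, |δ e| ≤ δmax)
    {q₀ : ℝ} {β : ℝ} (hβ : klBetaMin ≤ β) {n' : ℕ} (hn' : n' ≤ nScales β + 1) (M : ℕ)
    (hD : |q₀| + δmax ≤ klScale klE0 n' / 4) :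
    ‖(∑ m ∈ range (n' + 1), ∑ m' ∈ range (n' + 1), β⁻¹ • ∑ i : MatsubaraIdx M, ∫ e,
        W e * (f m (matsubaraFreq β M i ^ 2 + e ^ 2) / (((matsubaraFreq β M i ^ 2 + e ^ 2 : ℝ)) : ℂ) * (I * (matsubaraFreq β M i) + e)) *
          (f' m' ((matsubaraFreq β M i + q₀) ^ 2 + (e + δ e) ^ 2) / ((((matsubaraFreq β M i + q₀) ^ 2 + (e + δ e) ^ 2 : ℝ)) : ℂ) *
              (I * ((matsubaraFreq β M i + q₀ : ℝ) : ℂ) + ((e + δ e : ℝ) : ℂ)))) -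
      (∑ m ∈ range (n' + 1), ∑ m' ∈ range (n' + 1), β⁻¹ • ∑ i : MatsubaraIdx M, ∫ e,
        W e * (f m (matsubaraFreq β M i ^ 2 + e ^ 2) / (((matsubaraFreq β M i ^ 2 + e ^ 2 : ℝ)) : ℂ) * (I * (matsubaraFreq β M i) + e)) *
          (f' m' (matsubaraFreq β M i ^ 2 + e ^ 2) / (((matsubaraFreq β M i ^ 2 + e ^ 2 : ℝ)) : ℂ) * (I * (matsubaraFreq β M i) + e)))‖ ≤
      4 / 3 * (1024 / Real.pi * Mf * (1584 * ℓ' + 6354 * Mf') * BW * (|q₀| + δmax)) / klScale klE0 n' := by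
  set ω : MatsubaraIdx M → ℝ := fun i => matsubaraFreq β M i with hω
  -- names for the integrand families
  set Φ : ℕ → ℝ → ℝ → ℂ := fun m k₀ e => f m (k₀ ^ 2 + e ^ 2) / (((k₀ ^ 2 + e ^ 2 : ℝ)) : ℂ) * (I * k₀ + e) with hΦ
  set Ψ : ℕ → ℝ → ℝ → ℂ := fun m k₀ e => f' m (k₀ ^ 2 + e ^ 2) / (((k₀ ^ 2 + e ^ 2 : ℝ)) : ℂ) * (I * k₀ + e) with hΨ
  -- continuity in `e` and compact support of every pair integrand
  have hcontΦ : ∀ m k₀, Continuous fun e => Φ m k₀ e := by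
    intro m k₀
    have hr₁ : 0 < klScale klE0 m / 2 := by linarith [klth_klScale_pos m]
    have hr : 0 < 4 * klScale klE0 m := by linarith [klth_klScale_pos m]
    exact klsp_continuous_snd (fun s s' => klsp_div_lipschitz (hlip m) (hbd m) (hin m) hr₁ s s') (fun s => klsp_div_norm_le (hbd m) (hin m) hr₁ s)
      (fun s hs => by simp only [hout m s hs, zero_div]) hr k₀
  have hcontΨ : ∀ m k₀, Continuous fun e => Ψ m k₀ e := by
    intro m k₀
    have hr₁ : 0 < klScale klE0 m / 2 := by linarith [klth_klScale_pos m]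
    have hr : 0 < 4 * klScale klE0 m := by linarith [klth_klScale_pos m]
    exact klsp_continuous_snd (fun s s' => klsp_div_lipschitz (hlip' m) (hbd' m) (hin' m) hr₁ s s') (fun s => klsp_div_norm_le (hbd' m) (hin' m) hr₁ s)
      (fun s hs => by simp only [hout' m s hs, zero_div]) hr k₀
  have hcontΨs : ∀ m k₀, Continuous fun e => Ψ m (k₀ + q₀) (e + δ e) := fun m k₀ =>
    (hcontΨ m (k₀ + q₀)).comp (continuous_id.add hδc)
  have hΦzero : ∀ m k₀ e, 4 * klScale klE0 m ≤ |e| → Φ m k₀ e = 0 := fun m k₀ e he =>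
    klsp_zero_of_le_abs_snd (g := fun s : ℝ => f m s / ((s : ℝ) : ℂ)) (fun s hs => by simp only [hout m s hs, zero_div])
      (by linarith [klth_klScale_pos m]) k₀ he
  have hint1 : ∀ m m' (k₀ : ℝ), Integrable fun e : ℝ => W e * Φ m k₀ e * Ψ m' k₀ e := by
    intro m m' k₀
    have hcont : Continuous fun e : ℝ => W e * Φ m k₀ e * Ψ m' k₀ e := (hW.mul (hcontΦ m k₀)).mul (hcontΨ m' k₀)
    refine hcont.integrable_of_hasCompactSupport ?_
    refine HasCompactSupport.intro (isCompact_Icc (a := -(4 * klScale klE0 m)) (b := 4 * klScale klE0 m)) fun e he => ?_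
    rw [hΦzero m k₀ e (klsp_le_abs_of_not_mem_Icc he), mul_zero, zero_mul]
  have hint2 : ∀ m m' (k₀ : ℝ), Integrable fun e : ℝ => W e * Φ m k₀ e * Ψ m' (k₀ + q₀) (e + δ e) := by
    intro m m' k₀
    have hcont : Continuous fun e : ℝ => W e * Φ m k₀ e * Ψ m' (k₀ + q₀) (e + δ e) := (hW.mul (hcontΦ m k₀)).mul (hcontΨs m' k₀)
    refine hcont.integrable_of_hasCompactSupport ?_
    refine HasCompactSupport.intro (isCompact_Icc (a := -(4 * klScale klE0 m)) (b := 4 * klScale klE0 m)) fun e he => ?_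
    rw [hΦzero m k₀ e (klsp_le_abs_of_not_mem_Icc he), mul_zero, zero_mul]
  -- the difference of the two double sums is the double sum of the pair perturbations
  have hdiff : (∑ m ∈ range (n' + 1), ∑ m' ∈ range (n' + 1), β⁻¹ • ∑ i : MatsubaraIdx M, ∫ e, W e * Φ m (ω i) e * Ψ m' (ω i + q₀) (e + δ e)) -
      (∑ m ∈ range (n' + 1), ∑ m' ∈ range (n' + 1), β⁻¹ • ∑ i : MatsubaraIdx M, ∫ e, W e * Φ m (ω i) e * Ψ m' (ω i) e) =
      ∑ m ∈ range (n' + 1), ∑ m' ∈ range (n' + 1), β⁻¹ • ∑ i : MatsubaraIdx M, ∫ e,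
        W e * Φ m (ω i) e * (Ψ m' (ω i + q₀) (e + δ e) - Ψ m' (ω i) e) := by
    rw [← sum_sub_distrib]
    refine sum_congr rfl fun m _ => ?_
    rw [← sum_sub_distrib]
    refine sum_congr rfl fun m' _ => ?_
    rw [← smul_sub, ← sum_sub_distrib]
    congr 1
    refine sum_congr rfl fun i _ => ?_
    rw [← integral_sub (hint2 m m' (ω i)) (hint1 m m' (ω i))]
    refine integral_congr_ae (Filter.Eventually.of_forall fun e => ?_)
    simp only
    ring
  have hlaw := kllb_ladder_bubble_shift_norm_le hbd hin hout hlip' hbd' hLf' hin' hout' hBW hWbd hδ0 hδ hβ hn' M hD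
  change ‖(∑ m ∈ range (n' + 1), ∑ m' ∈ range (n' + 1), β⁻¹ • ∑ i : MatsubaraIdx M, ∫ e, W e * Φ m (ω i) e * Ψ m' (ω i + q₀) (e + δ e)) -
      (∑ m ∈ range (n' + 1), ∑ m' ∈ range (n' + 1), β⁻¹ • ∑ i : MatsubaraIdx M, ∫ e, W e * Φ m (ω i) e * Ψ m' (ω i) e)‖ ≤ _
  rw [hdiff]
  refine (norm_sum_le _ _).trans ((sum_le_sum fun m _ => norm_sum_le _ _).trans ?_)
  exact hlaw

end Lipschitz

end Summit.HubbardSuperconductivity.HubbardSuperconductivity.Theorems.KLRegimeSplit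

end
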